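import Mathlib
import Summits.NavierStokesRegularity.NavierStokesRegularity.Theorems.SubOnsagerCeilingGapFamily
import HarnessLib

/-!
# The design «d144θ» as a `GapFamily.Params` datum, with its admissibility
(helper file for crux stmt-NavierStokesRegularity-27057 `SubOnsagerCeiling.ForwardTailCeilingKP`, `--supports … --as helper`;
LEAD SOC g12, line «kp-shell-barrier», parametric route)

`d144θ` = the coefficients found by the LEAD g12 bound-based certifier-in-the-loop fitter (`fit3.py` = g11's `fit2.py` with a C simplex,
parallel face builds and the cubic-floor coefficient `κ` FREED — the lever that makes the slice certifiable: the caps need `κ(49/50)³ − ε ≥ x²/(p·49/50)`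
up to the seam with the quadric floors, so `κ` must rise as `p = b^(197/200)` falls; here `κ = 46439/100000`) for the slice `b ∈ [36/25, 29/20]`;
same topology as «d45»/«d147θ»/«d145θ» (caps 49/50, cubic floors `κx³ − ε`, two corner caps, bulk + carve quadric floors).
`d144θ_adm : d144θ.Adm` (decided by `norm_num`) and `d144θ_a0 : d144θ.a0 ≠ 0`. HONEST FRAMING: MODEL-lattice datum; nothing
here bears on Navier–Stokes regularity; 27057 stays OPEN. [cite: BarbatoMorandinRomito2011, §2 Lemma 2.1]
-/

noncomputable section

-- the sub-problem namespace `NavierStokesRegularity.NavierStokesRegularity` is the tree's layout (D-0017)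
set_option linter.dupNamespace false

namespace Summit.NavierStokesRegularity.NavierStokesRegularity.Theorems.VirtualFloor.GapFamily

/-- The design «d144θ». [folklore] -/
def d144θ : Params := { kap := (46439/100000), eps := (1/1000), a0 := (11811/4000), a1 := (26139/25000), a2 := (1471/50000), ac := (370843/100000), b1 := (92899/50000), bc := (266881/100000), fc := (-54349/10000), f0 := (21009/20000), f1 := (112601/20000), f2 := (171101/100000), f00 := (1/12500), f11 := (48333/50000), f22 := (83681/20000), f01 := (211/100000), f02 := (-23809/20000), f12 := (-76753/12500), gc := (-174837/50000), g0 := (54419/100000), g1 := (50521/10000), g2 := (-550029/100000), g00 := (6889/100000), g11 := (261/50000), g22 := (229809/50000), g01 := (1231/12500), g02 := (-2043/100000), g12 := (-647/10000) }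

/-- «d144θ» is admissible. [folklore] -/
theorem d144θ_adm : d144θ.Adm := by
  constructor <;> norm_num [d144θ, Params.pos]

/-- Its corner-cap A leading coefficient is non-zero. [folklore] -/
theorem d144θ_a0 : d144θ.a0 ≠ 0 := by norm_num [d144θ]

end Summit.NavierStokesRegularity.NavierStokesRegularity.Theorems.VirtualFloor.GapFamily

end
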